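import Summits.KontsevichZagierPeriods.KontsevichZagierPeriods.Theorems.SoloInformedArcGood
import Summits.KontsevichZagierPeriods.KontsevichZagierPeriods.Theorems.SoloInformedCuspBranch

/-!
# Cusp pieces of a semialgebraic arc: the étale datum (Rung 2, file E4c)

Solo programme `solo-KontsevichZagierPeriods-informed`, step L4 of `paper/rung2-v2.md`.

Let `ρ = [(a, b), g]` have a continuous bounded `ℚ`-semialgebraic integrand with a Bezout relation
`A p + B ∂_y p = c₁(x)` (`p(t, g t) = 0`, file E1), and let `c₀ ∈ (a, b)⁻` be a real algebraic point
approached from the side `ϵ = ±1`. By file E4b the function `x′ ↦ g(c₀ + ϵ x′)` has an étale germ: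
`g(c₀ + ϵ sⁿ) = U(s) + s^m ρ̃(s)` with `G(s, ρ̃ s) = 0`, `∂_w G ≠ 0` on a disc. For every rational
`q`
with `κ = ϵ (q − c₀) > 0` small, the Huber–Wüstholz symbol on the étale graph curve `Z_G` with the
Nash path `t ↦ (κ^{1/n} t², ρ̃(κ^{1/n} t²), ·)` and the form `(U(s) + s^m w) · n s^{n−1} ds`
is constructed here (`SoloInformedCuspPiece.datum`, with the scale `κ`, the root `s₂ = κ^{1/n}`,
admissibility of `q`, and the germ identity `ρ̃(u) = (g(c₀ + ϵ κ t^{2n}) − U(u))/u^m` along the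
path); file E4d proves that it is a Nash symbol with `κ̃(σ) = (⟦[side(c₀, q), g]⟧, 0)`.
[Huber–Wüstholz 2022, §13.1; Kontsevich–Zagier 2001, §1.2; Bochnak–Coste–Roy 1998, §8.1]
-/

noncomputable section

open Set Filter Topology MeasureTheory Metric
open scoped Polynomial
open Literature.NumberTheory.Transcendental Literature.NumberTheory.Transcendental.KZ
open Literature.NumberTheory.Transcendental.CurvePeriods Literature.ModelTheory.ExponentialFields

namespace Summit.KontsevichZagierPeriods.KontsevichZagierPeriods.Theorems

/-! ## 1. Evaluation over `ℚ̄` and algebraic roots -/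

/-- `G(s, W)` at `s ∈ ℚ̄` is the evaluation of the specialised polynomial `G(s, ·) ∈ ℚ̄[w]`. -/
theorem soloInformed_evC_algebraMap (G : SoloInformedQbar[X][X]) (sK : SoloInformedQbar) (W : ℂ) :
    soloInformedEvC G (algebraMap SoloInformedQbar ℂ sK) W =
      ((G.map (Polynomial.evalRingHom sK)).map (algebraMap SoloInformedQbar ℂ)).eval W := by
  have h : Polynomial.eval₂RingHom (algebraMap SoloInformedQbar ℂ)
      (algebraMap SoloInformedQbar ℂ sK) =
      (algebraMap SoloInformedQbar ℂ).comp (Polynomial.evalRingHom sK) := by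
    refine Polynomial.ringHom_ext (fun a => ?_) ?_
    · simp
    · simp
  unfold soloInformedEvC
  rw [h, ← Polynomial.map_map]

/-- **A simple root of `G(s, ·)`, `s ∈ ℚ̄`, is algebraic.** [folklore] -/
theorem soloInformed_isAlgebraic_root (G : SoloInformedQbar[X][X]) (sK : SoloInformedQbar) {w : ℂ}
    (h0 : soloInformedEvC G (algebraMap SoloInformedQbar ℂ sK) w = 0)
    (h1 : soloInformedEvC (Polynomial.derivative G) (algebraMap SoloInformedQbar ℂ sK) w ≠ 0) :
    IsAlgebraic ℚ w := by
  haveI : Algebra.IsAlgebraic ℚ SoloInformedQbar := algebraicClosure.isAlgebraic ℚ ℂ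
  set q : SoloInformedQbar[X] := G.map (Polynomial.evalRingHom sK) with hq
  have hq0 : q ≠ 0 := by
    intro h
    apply h1
    rw [soloInformed_evC_algebraMap, ← Polynomial.derivative_map, ← hq, h,
      Polynomial.derivative_zero, Polynomial.map_zero, Polynomial.eval_zero]
  have hyK : IsAlgebraic SoloInformedQbar w := by
    refine ⟨q, hq0, ?_⟩
    rw [Polynomial.aeval_def, ← Polynomial.eval_map, hq, ← soloInformed_evC_algebraMap, h0]
  have hKint : Algebra.IsIntegral ℚ SoloInformedQbar :=
    Algebra.isAlgebraic_iff_isIntegral.mp inferInstance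
  exact isAlgebraic_iff_isIntegral.2 (isIntegral_trans w (isAlgebraic_iff_isIntegral.1 hyK))

/-- The parameter set `(−ε, 1 + ε) ⊆ ℝ¹` is semialgebraic. -/
theorem soloInformed_isSemialgebraic_margin (ε : ℚ) :
    IsSemialgebraic ℚ (soloInformedIoo1 (-(ε : ℝ)) (1 + ε)) := by
  have h := isSemialgebraic_soloInformedIoo1 (-ε) (1 + ε)
  push_cast at h
  exact h

/-! ## 2. Cusp pieces -/

/-- **A cusp piece**: an arc `ρ = [(a, b), g]` (continuous, bounded, with a Bezout relation) and
an algebraic point `c₀` with `c₀ + ϵ x ∈ (a, b)` for `0 < x < η` (`ϵ = ±1`). -/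
structure SoloInformedCuspPiece where
  /-- The arc representation. -/
  ρ : IntegralRep 1
  /-- Left end of the arc. -/
  a : ℝ
  /-- Right end of the arc. -/
  b : ℝ
  /-- The domain is the open interval `(a, b)`. -/
  dom : ρ.domain = soloInformedIoo1 a b
  /-- The integrand is continuous. -/
  cont : ContinuousOn ρ.integrand ρ.domain
  /-- A bound for the integrand. -/
  M : ℝ
  /-- The integrand is bounded. -/
  bdd : ∀ t ∈ Ioo a b, |soloInformedArcFun ρ t| ≤ M
  /-- The relation. -/
  p : ℚ[X][X]
  /-- First Bezout coefficient. -/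
  A : ℚ[X][X]
  /-- Second Bezout coefficient. -/
  B : ℚ[X][X]
  /-- The Bezout element. -/
  c₁ : ℚ[X]
  /-- The Bezout element is non-zero. -/
  c₁_ne : c₁ ≠ 0
  /-- The Bezout identity. -/
  bez : A * p + B * Polynomial.derivative p = Polynomial.C c₁
  /-- `p(t, g t) = 0` on `(a, b)`. -/
  rel : ∀ t ∈ Ioo a b, soloInformedEvR t (soloInformedArcFun ρ t) p = 0
  /-- The cusp point. -/
  c₀ : ℝ
  /-- The cusp point is algebraic. -/
  c₀_alg : IsAlgebraic ℚ c₀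
  /-- The side. -/
  ϵ : ℚ
  /-- The side is `±1`. -/
  sign : ϵ = 1 ∨ ϵ = -1
  /-- Length of the one-sided neighbourhood. -/
  η : ℝ
  /-- The one-sided neighbourhood is non-empty. -/
  η_pos : 0 < η
  /-- The one-sided neighbourhood lies in the arc. -/
  side : ∀ x ∈ Ioo (0 : ℝ) η, c₀ + ϵ * x ∈ Ioo a b

namespace SoloInformedCuspPiece

variable (P : SoloInformedCuspPiece)

/-- The integrand `g`. -/
def g : ℝ → ℝ := soloInformedArcFun P.ρ

/-- `p ≠ 0`. -/
theorem p_ne : P.p ≠ 0 := by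
  intro h
  have hb := P.bez
  rw [h, Polynomial.derivative_zero, mul_zero, mul_zero, zero_add] at hb
  exact P.c₁_ne (Polynomial.C_eq_zero.1 hb.symm)

/-- `ϵ ≠ 0`. -/
theorem ϵ_ne : P.ϵ ≠ 0 := by rcases P.sign with h | h <;> rw [h] <;> norm_num

/-- `ϵ² = 1` (real form). -/
theorem ϵ_mul_ϵ : (P.ϵ : ℝ) * P.ϵ = 1 := by rcases P.sign with h | h <;> rw [h] <;> norm_num

/-- The cusp point as an element of `ℚ̄`. -/
def c₀K : SoloInformedQbar :=
  ⟨(P.c₀ : ℂ), mem_algebraicClosure_iff.2 (by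
    have hR : ∀ {x : ℝ}, IsAlgebraic ℚ x → IsAlgebraic ℚ (x : ℂ) := fun hx => by
      simpa using hx.algebraMap (A := ℂ)
    exact hR P.c₀_alg)⟩

/-- `c₀K = c₀` in `ℂ`. -/
theorem algebraMap_c₀K : algebraMap SoloInformedQbar ℂ P.c₀K = (P.c₀ : ℂ) := rfl

/-- The affine side map is continuous. -/
theorem continuous_affine : Continuous fun x : ℝ => P.c₀ + P.ϵ * x :=
  continuous_const.add (continuous_const.mul continuous_id)

/-- **The input of the cusp analysis** (file E4b): `G₀ x′ = g(c₀ + ϵ x′)`, `P = p(c₀ + ϵ x′, y)`. -/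
def input : SoloInformedCuspInput where
  G₀ x := P.g (P.c₀ + P.ϵ * x)
  η := P.η
  η_pos := P.η_pos
  cont := by
    have hc : Continuous fun t : ℝ => (fun _ : Fin 1 => t) := continuous_pi fun _ => continuous_id
    have hg : ContinuousOn P.g (Ioo P.a P.b) := P.cont.comp hc.continuousOn fun t ht => by
      rw [P.dom]; exact ht
    exact hg.comp P.continuous_affine.continuousOn P.side
  M := P.M
  bdd x hx := P.bdd _ (P.side x hx)
  P := soloInformedPc P.p P.c₀K P.ϵ
  P_ne := soloInformed_Pc_ne_zero P.p_ne P.c₀K P.ϵ_ne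
  sep := soloInformed_separable_Pc P.c₁_ne P.bez P.c₀K P.ϵ_ne
  rel x hx := by
    rw [soloInformed_evC_Pc, algebraMap_c₀K]
    have h : (P.c₀ : ℂ) + ((P.ϵ : ℚ) : ℂ) * ((x : ℝ) : ℂ) = ((P.c₀ + P.ϵ * x : ℝ) : ℂ) := by
      push_cast
      ring
    rw [h, show ((P.g (P.c₀ + P.ϵ * x) : ℝ) : ℂ) =
      ((soloInformedArcFun P.ρ (P.c₀ + P.ϵ * x) : ℝ) : ℂ) from rfl, soloInformed_evC_ofReal,
      Complex.ofReal_eq_zero]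
    exact P.rel _ (P.side x hx)

/-- **The étale germ** of the cusp piece (file E4b). -/
def germ : SoloInformedCuspGerm P.input := P.input.nonempty_germ.some

/-- `G₀(u) = g(c₀ + ϵ u)`. -/
theorem input_G₀ (u : ℝ) : P.input.G₀ u = P.g (P.c₀ + P.ϵ * u) := rfl

/-! ## 3. The scale `κ = ϵ (q − c₀)` and the root `s₂ = κ^{1/n}` -/

/-- The scale `κ = ϵ (q − c₀)`. -/
def κ (q : ℚ) : ℝ := P.ϵ * (q - P.c₀)

/-- `κ` is algebraic. -/
theorem κ_alg (q : ℚ) : IsAlgebraic ℚ (P.κ q) :=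
  (isAlgebraic_algebraMap (P.ϵ : ℚ)).mul ((isAlgebraic_algebraMap (q : ℚ)).sub P.c₀_alg)

/-- `c₀ + ϵ κ = q`. -/
theorem c₀_add (q : ℚ) : P.c₀ + P.ϵ * P.κ q = q := by
  unfold κ
  have h := P.ϵ_mul_ϵ
  linear_combination ((q : ℝ) - P.c₀) * h

/-- The root `s₂ = κ^{1/n}`. -/
def s₂ (q : ℚ) : ℝ := P.κ q ^ ((P.germ.n : ℝ)⁻¹)

/-- **Admissible far ends** `q`: `0 < κ` and `4 s₂ < r`. -/
def Admissible (q : ℚ) : Prop := 0 < P.κ q ∧ 4 * P.s₂ q < P.germ.r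

/-- Admissible far ends exist arbitrarily close to `c₀` on the side `ϵ`. -/
theorem exists_admissible :
    ∃ κ₀ : ℝ, 0 < κ₀ ∧ ∀ q : ℚ, 0 < P.κ q → P.κ q < κ₀ → P.Admissible q := by
  have hr := P.germ.r_pos
  have hn : (0 : ℝ) < P.germ.n := by exact_mod_cast P.germ.n_pos
  refine ⟨(P.germ.r / 4) ^ (P.germ.n : ℝ), Real.rpow_pos_of_pos (by linarith) _,
    fun q h0 h1 => ⟨h0, ?_⟩⟩
  have h2 : P.s₂ q < ((P.germ.r / 4) ^ (P.germ.n : ℝ)) ^ ((P.germ.n : ℝ)⁻¹) :=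
    Real.rpow_lt_rpow h0.le h1 (inv_pos.2 hn)
  rw [← Real.rpow_mul (by linarith), mul_inv_cancel₀ hn.ne', Real.rpow_one] at h2
  linarith

variable {P}
variable {q : ℚ} (hq : P.Admissible q)
include hq

/-- `0 < s₂`. -/
theorem s₂_pos : 0 < P.s₂ q := Real.rpow_pos_of_pos hq.1 _

/-- `s₂ⁿ = κ`. -/
theorem s₂_pow : P.s₂ q ^ P.germ.n = P.κ q := by
  have hn : (P.germ.n : ℝ) ≠ 0 := by exact_mod_cast P.germ.n_pos.ne'
  rw [s₂, ← Real.rpow_natCast, ← Real.rpow_mul hq.1.le, inv_mul_cancel₀ hn, Real.rpow_one]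

/-- `s₂` is algebraic. -/
theorem s₂_alg : IsAlgebraic ℚ (P.s₂ q) :=
  IsAlgebraic.of_pow P.germ.n_pos (by rw [s₂_pow hq]; exact P.κ_alg q)

/-- For `t ∈ (−1, 2)`, `s₂ t²` lies in the disc of the germ. -/
theorem mem_ball {t : ℝ} (ht : t ∈ Ioo (-((1 : ℚ) : ℝ)) (1 + (1 : ℚ))) :
    (((P.s₂ q * t ^ 2 : ℝ)) : ℂ) ∈ ball (0 : ℂ) P.germ.r := by
  have hs := s₂_pos hq
  simp only [Rat.cast_one, mem_Ioo] at ht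
  rw [Metric.mem_ball, dist_zero_right, Complex.norm_real, Real.norm_eq_abs,
    abs_of_nonneg (by positivity)]
  have ht2 : t ^ 2 < 4 := by nlinarith [ht.1, ht.2]
  nlinarith [hq.2, ht2]

/-- For `t ∈ (−1, 2)`, `t ≠ 0`, `u = s₂ t²` lies in `(0, r)`. -/
theorem mem_Ioo {t : ℝ} (ht : t ∈ Ioo (-((1 : ℚ) : ℝ)) (1 + (1 : ℚ))) (ht0 : t ≠ 0) :
    P.s₂ q * t ^ 2 ∈ Ioo (0 : ℝ) P.germ.r := by
  have hs := s₂_pos hq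
  simp only [Rat.cast_one, Set.mem_Ioo] at ht
  have ht2 : t ^ 2 < 4 := by nlinarith [ht.1, ht.2]
  exact ⟨mul_pos hs (by positivity), by nlinarith [hq.2, ht2]⟩

/-- **The germ identity along the path**: for `u = s₂ t² ∈ (0, r)`,
`ρ̃(u) = (g(c₀ + ϵ κ t^{2n}) − U(u)) / u^m`. -/
theorem ρ_eq {t : ℝ} (ht : t ∈ Ioo (-((1 : ℚ) : ℝ)) (1 + (1 : ℚ))) (ht0 : t ≠ 0) :
    P.germ.ρ ((P.s₂ q * t ^ 2 : ℝ) : ℂ) =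
      (((P.g (P.c₀ + P.ϵ * P.κ q * t ^ (2 * P.germ.n)) : ℝ) : ℂ) -
        Polynomial.eval₂ (algebraMap SoloInformedQbar ℂ) ((P.s₂ q * t ^ 2 : ℝ) : ℂ) P.germ.U) /
        ((P.s₂ q * t ^ 2 : ℝ) : ℂ) ^ P.germ.m := by
  have hu := mem_Ioo hq ht ht0
  have h := P.germ.real _ hu
  have hpow : (P.s₂ q * t ^ 2) ^ P.germ.n = P.κ q * t ^ (2 * P.germ.n) := by
    rw [mul_pow, s₂_pow hq, ← pow_mul]
  rw [input_G₀, hpow, show P.ϵ * (P.κ q * t ^ (2 * P.germ.n)) =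
    P.ϵ * P.κ q * t ^ (2 * P.germ.n) by ring] at h
  have hu0 : ((P.s₂ q * t ^ 2 : ℝ) : ℂ) ≠ 0 := by exact_mod_cast hu.1.ne'
  rw [eq_div_iff (pow_ne_zero _ hu0), h]
  ring

/-! ## 4. The étale datum and the symbol of a cusp piece -/

/-- `s₂` as an element of `ℚ̄`. -/
def s₂K : SoloInformedQbar :=
  ⟨(P.s₂ q : ℂ), mem_algebraicClosure_iff.2 (by
    have hR : ∀ {x : ℝ}, IsAlgebraic ℚ x → IsAlgebraic ℚ (x : ℂ) := fun hx => by
      simpa using hx.algebraMap (A := ℂ)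
    exact hR (s₂_alg hq))⟩

/-- **The étale datum of a cusp piece at an admissible far end.** -/
def datum : SoloInformedEtaleDatum SoloInformedQbar where
  G := P.germ.G
  H := (Polynomial.C P.germ.U + Polynomial.C (Polynomial.X ^ P.germ.m) * Polynomial.X) *
    Polynomial.C (Polynomial.C (P.germ.n : SoloInformedQbar) * Polynomial.X ^ (P.germ.n - 1))
  s t := ((P.s₂ q * t ^ 2 : ℝ) : ℂ)
  Y t := P.germ.ρ ((P.s₂ q * t ^ 2 : ℝ) : ℂ)
  ε := 1
  ε_pos := one_pos
  s_contDiff :=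
    (Complex.ofRealCLM.contDiff.comp (contDiff_const.mul (contDiff_id.pow 2))).contDiffOn
  Y_contDiff t ht := by
    have h1 : ContDiffAt ℝ 1 (fun t : ℝ => ((P.s₂ q * t ^ 2 : ℝ) : ℂ)) t :=
      (Complex.ofRealCLM.contDiff.comp (contDiff_const.mul (contDiff_id.pow 2))).contDiffAt
    have h2 : ContDiffAt ℝ 1 P.germ.ρ ((P.s₂ q * t ^ 2 : ℝ) : ℂ) :=
      ((P.germ.analytic _ (mem_ball hq ht)).contDiffAt (n := 1)).restrict_scalars ℝ
    exact (h2.comp t h1).contDiffWithinAt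
  root t ht := P.germ.root _ (mem_ball hq ht)
  etale t ht := P.germ.etale _ (mem_ball hq ht)
  s_zero := by norm_num; exact isAlgebraic_zero
  Y_zero := by
    norm_num
    rw [P.germ.ρ_zero]
    exact soloInformed_hK_Qbar _
  s_one := by
    have hR : ∀ {x : ℝ}, IsAlgebraic ℚ x → IsAlgebraic ℚ (x : ℂ) := fun hx => by
      simpa using hx.algebraMap (A := ℂ)
    norm_num
    exact hR (s₂_alg hq)
  Y_one := by
    have h1 : (1 : ℝ) ∈ Ioo (-((1 : ℚ) : ℝ)) (1 + (1 : ℚ)) := by norm_num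
    have hs : ((P.s₂ q * (1 : ℝ) ^ 2 : ℝ) : ℂ) = algebraMap SoloInformedQbar ℂ (s₂K hq) := by
      norm_num; rfl
    refine soloInformed_isAlgebraic_root P.germ.G (s₂K hq) ?_ ?_
    · rw [← hs]; exact P.germ.root _ (mem_ball hq h1)
    · rw [← hs]; exact P.germ.etale _ (mem_ball hq h1)

/-- **The symbol of a cusp piece.** -/
abbrev symbol : PeriodSymbol := (datum hq).symbol soloInformed_hK_Qbar

/-- The parameter set `S = (−1, 2) ⊆ ℝ¹`. -/
abbrev S1 : Set (Fin 1 → ℝ) := soloInformedIoo1 (-((1 : ℚ) : ℝ)) (1 + (1 : ℚ))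

end SoloInformedCuspPiece

end Summit.KontsevichZagierPeriods.KontsevichZagierPeriods.Theorems
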